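import Summits.BirchSwinnertonDyer.BirchSwinnertonDyer.Theorems.GoldfeldAllTwistsTwoConverseTwinQuarterTraceChiZCore
import Summits.BirchSwinnertonDyer.BirchSwinnertonDyer.Theorems.GoldfeldAllTwistsTwoConverseTwinQuarterTraceChiZPrep
import Summits.BirchSwinnertonDyer.BirchSwinnertonDyer.Theorems.GoldfeldAllTwistsTwoConverseTwinQuarterTraceSignaturesEAlphaModFourAlpha
import Summits.BirchSwinnertonDyer.BirchSwinnertonDyer.Theorems.GoldfeldAllTwistsTwoConverseTwinQuarterTraceSignaturesPAlphaModFourAlpha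
import Summits.BirchSwinnertonDyer.BirchSwinnertonDyer.Theorems.GoldfeldAllTwistsTwoConverseTwinQuarterTraceSignaturesQPModFourAlpha
import Summits.BirchSwinnertonDyer.BirchSwinnertonDyer.Theorems.GoldfeldAllTwistsTwoConverseTwinQuarterTraceChiZNonTorsion
import Summits.BirchSwinnertonDyer.BirchSwinnertonDyer.Theorems.GoldfeldAllTwistsTwoConverseTwinQuarterTraceChiZAlpha
import Summits.BirchSwinnertonDyer.BirchSwinnertonDyer.Theorems.GoldfeldAllTwistsTwoConverseTwinQuarterTracePartnerPHeightModFour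
import HarnessLib

set_option linter.dupNamespace false -- namespace `…BirchSwinnertonDyer.BirchSwinnertonDyer…` is the cell's (D-0017 nested layout)
set_option autoImplicit false

/-!
# C7A tranche Z (RULING (ccclx)), file Z2: the QUARTER POINT with `χ_Z(σ̃_p) = T` on EVERY type-α cell with `q ≡ 7 (8)`, `p ≡ 1 (mod 4)` (C4 and C7A), GRANTED
# `h2 : r_an(49a1^{(−qp)}) = 1` — X5α-χ twinned hp4-generically on the P/Q/E package twins — and **the conductor-`1` Heegner trace is NON-TORSION** by the
# χ_Z channel (`trace_not_isOfFinAddOrder_of_quarterPoint`, file Z1), WITHOUT the `(1+c)`-parity (†)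

Cell `bsd-goldfeld`, seat `bsd-goldfeld-s1p-c3x` (gen 13). §1 = MECHANICAL TWIN of `exists_quarterPoint_chiZ_alpha` (`…TwinQuarterTraceChiZAlpha` :57; generator
`work/twingen.py`): statement letter-identical except `hp8 : p % 8 = 5` ↦ `hp4 : p % 4 = 1` and the package names `+_modFourAlpha`. §2 (NEW, 15 lines):
`heegnerTrace_not_isOfFinAddOrder_alpha_modFour_of_h2` = Z1 ∘ §1. `--supports stmt-BirchSwinnertonDyer-20044` as a HELPER (rank axis). Theses-free; theorems only;
no definition, no new fact, no `sorry`. Binders BY NAME = X5α-χ's (hEta₀ hD hEta h14 hCST hGZ h12 h44 hS31 hnew hBT hBF hGZK + h2 + carry data). FRONTIER-grade: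
density-zero sub-families modulo named print; never distance-to-summit. HONEST FRAMING: conditional on `h2` (discharged on C7A by D3, on C4 by X0); items
19140 / 20044 unchanged; BSD is not proved by any of this.
-/

noncomputable section

open scoped Classical IntermediateField

open WeierstrassCurve NumberField Literature.NumberTheory Literature.NumberTheory.EllipticCurves
  Literature.NumberTheory.EllipticCurves.ModularForms Literature.NumberTheory.EllipticCurves.CaiShuTian2014
  Literature.NumberTheory.EllipticCurves.CoatesLiTianZhai2015 Literature.Computability.Cryptography.Hallgren2005

namespace Summit.BirchSwinnertonDyer.BirchSwinnertonDyer.Theorems.GoldfeldGoodTwists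

-- the cell's point-group world over `K[1]` / `ℂ` (A⁗_α's, X1's); file-local
attribute [local instance 2000] Classical.propDecidable

/-! ## §1 The quarter point of the α cell in `X₀(49)(K[1])` and its χ_Z-signature `σ̃_p(n•Z) − n•Z = T` -/
section QuarterPoint
variable {K : Type} [Field K] [NumberField K] (ι : K →+* ℂ) [FiniteDimensional K (ringClassField K ι 1)]
  [IsGalois K (ringClassField K ι 1)] [NumberField (ringClassField K ι 1)]

/-- **The quarter point with `χ_Z(σ̃_p) = T`, type α, under `h2`.** Packages of X3a/X3α-2/X3α-3c, carry binders `hA`, `har`, `h4e`,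
`hSK` and the genus subgroup data as in A⁗_α; for a lift `σ̃` (`σ̃r_q = r_q`, `σ̃r_p = −r_p`): an odd `N`, `Z`, `t ∈ {O, T}` with
`4•Z = N•Σ_σ σy_K + t` and an odd `n` with `σ̃(n•Z) − n•Z = T`. [cite: Gross1984, §§4–5] [cite: GrossLMS1991, Prop. 5.3]
[cite: CoatesLiTianZhai2015, Thm. 1.3, 1.4, 4.4 and (2.8)] -/
theorem exists_quarterPoint_chiZ_alpha_modFourAlpha (hEta₀ : x049_x_sub_two_eq_etaQuotient) (hD : deuring_etaQuotient49_heegner_generates_conjPrime)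
    (hEta : x049_heegner_norm_x_sub_two_not_mem) (h14 : thm14_rankOne_twist) (hCST : thm11_ringClassChar)
    (hGZ : ∀ (N : ℕ) [NeZero N] (W : WeierstrassCurve ℚ) (K : Type) [Field K] [NumberField K], gross_zagier N W K)
    (h12 : thm12_fullBSD_twist) (h44 : thm44_ord_two_LAlg)
    (hS31 : bsdTriple_of_rank_le_one_of_conductor_lt) (hnew : exists_isNewformOf)
    (hBT : burungaleTian_analyticRank_eq_zero_of_selmerCorank_eq_zero_of_hasCM) (hBF : bsdTriple_of_hasCM_of_L_one_ne_zero)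
    (hGZK : rank_eq_analyticRank_of_analyticRank_le_one)
    (hK : IsImaginaryQuadratic K) {q p : ℕ} (hq : q.Prime) (hq8 : q % 8 = 7) (hq7 : jacobiSym q 7 = -1)
    [Fact p.Prime] (hp4 : p % 4 = 1) (hp7 : legendreSym p (-7) = 1) (hα : ¬ ∃ x : ZMod p, x ^ 4 = -7)
    (h4e : ∀ Δ : OrderCl.NegDiscr, Δ.D = -((q : ℤ) * p) → ¬ 4 ∣ Nat.card (ClassGroup (OrderCl.QO Δ)))
    (h2 : (haveI := cm7.isElliptic_quadraticTwist (show (-((q : ℚ) * p)) ≠ 0 from neg_ne_zero.mpr (mul_ne_zero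
        (by exact_mod_cast hq.ne_zero) (by exact_mod_cast (Fact.out : p.Prime).ne_zero)));
      (cm7.quadraticTwist (-((q : ℚ) * p))).analyticRank) = 1)
    (hA : ∀ (K₂ : Type) [Field K₂] [NumberField K₂], IsImaginaryQuadratic K₂ → NumberField.discr K₂ = -(8 * (q : ℤ)) →
      ∀ P : (cm7.baseChange K₂).toAffine.Point, IsHeegnerPoint 49 cm7 K₂ P → ¬ IsOfFinAddOrder P)
    (har : ∀ (W : WeierstrassCurve ℚ) [W.IsElliptic] (C : VariableChange ℚ),
      C • W = cm7.quadraticTwist ((-2 * q : ℤ) : ℚ) → W.analyticRank = 1)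
    (hdK : NumberField.discr K = -(8 * (q : ℤ) * p))
    (D₀ : ModularParametrizationData cm7 49) (hc : |D₀.c| = 1) (hw : cm7.rootNumber = 1)
    (h0 : ∃ h, D₀.cuspZeroPoint = Affine.Point.some 2 (-1) h)
    {β : ℤ} (d : KolyvaginHeegnerData D₀ β ι 1) {rq rp : ringClassField K ι 1}
    (hrq : (rq : ℂ) ^ 2 = -(q : ℂ)) (hrp : (rp : ℂ) ^ 2 = (p : ℂ))
    (B : AddSubgroup (cm7.baseChange ℂ).toAffine.Point) (S : Subfield ℂ)
    (hBfix : ∀ P : (cm7.baseChange (ringClassField K ι 1)).toAffine.Point,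
      (∀ σ : ringClassField K ι 1 ≃ₐ[K] ringClassField K ι 1, σ rq = rq → σ rp = rp →
        Affine.Point.map (σ : ringClassField K ι 1 →ₐ[K] ringClassField K ι 1) P = P) →
      Affine.Point.map (W' := cm7) (ringClassField K ι 1).subtype.toRatAlgHom P ∈ B)
    (hBodd : ∀ u ∈ B, IsOfFinAddOrder u → ∃ n : ℤ, Odd n ∧
      (n • u = 0 ∨ n • u = Affine.Point.some 2 (-1) (nonsingular_cm7_baseChange_two_neg_one ℂ)))
    (hBS : ∀ (E : Type) [Field E] [CharZero E] (e : E →+* ℂ), e.fieldRange ≤ S →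
      ∀ z : (cm7.baseChange E).toAffine.Point, Affine.Point.map (W' := cm7) e.toRatAlgHom z ∈ B)
    (hSK : ∀ k : K, ι k ∈ S) (hSq : (rq : ℂ) ∈ S) (hSp : (rp : ℂ) ∈ S)
    (hBL : ∀ z ∈ B, ∃ P : (cm7.baseChange (ringClassField K ι 1)).toAffine.Point,
      Affine.Point.map (W' := cm7) (ringClassField K ι 1).subtype.toRatAlgHom P = z)
    (h7 : ¬ IsSquare (-7 : ringClassField K ι 1)) (h7' : ¬ IsSquare (7 : ringClassField K ι 1))
    (σt : ringClassField K ι 1 ≃ₐ[K] ringClassField K ι 1) (hσq : σt rq = rq) (hσp : σt rp = -rp) :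
    ∃ (N : ℤ) (Z t : (cm7.baseChange (ringClassField K ι 1)).toAffine.Point), Odd N ∧
      (t = 0 ∨ t = Affine.Point.some 2 (-1) (nonsingular_cm7_baseChange_two_neg_one (ringClassField K ι 1))) ∧
      (4 : ℤ) • Z = N • (∑ σ : ringClassField K ι 1 ≃ₐ[K] ringClassField K ι 1,
          Affine.Point.map (σ : ringClassField K ι 1 →ₐ[K] ringClassField K ι 1) d.y) + t ∧
      ∃ n : ℤ, Odd n ∧ Affine.Point.map (σt : ringClassField K ι 1 →ₐ[K] ringClassField K ι 1) (n • Z) - n • Z =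
        Affine.Point.some 2 (-1) (nonsingular_cm7_baseChange_two_neg_one (ringClassField K ι 1)) := by
  haveI : (cm7.baseChange (ringClassField K ι 1)).IsElliptic := by rw [WeierstrassCurve.baseChange]; infer_instance
  have hp : p.Prime := Fact.out
  obtain ⟨hq4, h3, hq2, -⟩ := mod_eight_eq_seven_arith hq8
  have hrK := sq_eq_algebraMap_neg_natCast (ι := ι) hrq
  have hrpK := sq_eq_algebraMap_natCast' (ι := ι) hrp
  have hpL : (p : ringClassField K ι 1) ≠ 0 := by exact_mod_cast hp.ne_zero
  have hrp0 : rp ≠ 0 := by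
    intro h; rw [h, zero_pow two_ne_zero, map_natCast] at hrpK
    exact hpL hrpK.symm
  have hT2 : 2 • Affine.Point.some 2 (-1) (nonsingular_cm7_baseChange_two_neg_one (ringClassField K ι 1)) = 0 := by
    rw [two_nsmul]; exact cm7_twoTorsion_add_self _
  have h4 : ∀ x : (cm7.baseChange (ringClassField K ι 1)).toAffine.Point, (4 : ℤ) • x = 0 →
      x = 0 ∨ x = Affine.Point.some 2 (-1) (nonsingular_cm7_baseChange_two_neg_one (ringClassField K ι 1)) := fun x hx ↦
    cm7_mem_pair_of_four_zsmul_eq_zero h7 h7' hx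
  ------------------------------------------------------------------ X2's coordinates of `y₁ = d.y` and the non-square partial norms
  obtain ⟨x₁, y₁, hxy, hdy, hX2⟩ := exists_heegner_x_not_isSquare_seven_mul_prod hEta₀ hD hEta hK ι D₀ hc d
  have hx2 : x₁ ≠ 2 := fun h ↦ hX2 {1} (by
    rw [Finset.prod_singleton, AlgEquiv.one_apply, h, sub_self, mul_zero]; exact ⟨0, (mul_zero 0).symm⟩)
  ------------------------------------------------------------------ the three packages over `K[1]` (X3a, X3b-2b)
  obtain ⟨Mq, m, Y, tq, hMq, -, htq, hPq, hYfix, -⟩ := exists_chiQ_package_L_modFourAlpha ι h14 hCST hGZ h44 hBT hBF hnew hK hq h3 hq4 hq7 hp4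
    hp7 hα hdK D₀ hc hw h0 d hrq hrp
  obtain ⟨Mp, Rp, tp, hMp, htp, -, -, hPp, hsigP⟩ := exists_chiP_package_alpha_L_modFourAlpha ι hEta₀ hD hEta hCST hGZ h12 h44 h14 hS31 hnew
    hBT hBF hGZK hK hq hq8 hq7 hp4 hp7 hα hdK hA har D₀ hc hw h0 d hrq hrp B S hBfix hBS hSK hSq hSp hBL
  obtain ⟨Me, Re, te, hMe, hte, -, -, hPe, hsig⟩ := exists_chiE_package_alpha_L_modFourAlpha ι hEta₀ hD hEta h14 hCST hGZ h12 h44 hS31 hnew hBT hBF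
    hGZK hK hq h3 hq4 hq7 hp4 hp7 hα h4e hdK h2 D₀ hc hw h0 d hrq hrp B S hBfix hBodd hBS hSq hSp hBL
  have hte' := cm7_exists_odd_zsmul_mem_pair h7 h7' hte
  have htq' := cm7_exists_odd_zsmul_mem_pair h7 h7' htq
  have htp' := cm7_exists_odd_zsmul_mem_pair h7 h7' htp
  ------------------------------------------------------------------ the quarter trace `Ψ` and the quarter point `Z` (X5-prep)
  obtain ⟨Ψ, hΨ⟩ : ∃ X : (cm7.baseChange (ringClassField K ι 1)).toAffine.Point, X =
      ∑ σ : ringClassField K ι 1 ≃ₐ[K] ringClassField K ι 1, (@ite ℤ (σ rq = rq ∧ σ rp = rp) instDecidableAnd (1 : ℤ) 0) •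
        Affine.Point.map (σ : ringClassField K ι 1 →ₐ[K] ringClassField K ι 1) d.y := ⟨_, rfl⟩
  have hΨ4 : (4 : ℤ) • Ψ = (∑ σ : ringClassField K ι 1 ≃ₐ[K] ringClassField K ι 1,
        Affine.Point.map (σ : ringClassField K ι 1 →ₐ[K] ringClassField K ι 1) d.y) +
      (∑ σ : ringClassField K ι 1 ≃ₐ[K] ringClassField K ι 1,
        ((if σ rq = rq then (1 : ℤ) else -1) * (if σ rp = rp then (1 : ℤ) else -1)) •
          Affine.Point.map (σ : ringClassField K ι 1 →ₐ[K] ringClassField K ι 1) d.y) +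
      (∑ σ : ringClassField K ι 1 ≃ₐ[K] ringClassField K ι 1, (if σ rq = rq then (1 : ℤ) else -1) •
          Affine.Point.map (σ : ringClassField K ι 1 →ₐ[K] ringClassField K ι 1) d.y) +
      (∑ σ : ringClassField K ι 1 ≃ₐ[K] ringClassField K ι 1, (if σ rp = rp then (1 : ℤ) else -1) •
          Affine.Point.map (σ : ringClassField K ι 1 →ₐ[K] ringClassField K ι 1) d.y) := by
    rw [hΨ]
    exact quarterTrace_sum_identity (fun σ : ringClassField K ι 1 ≃ₐ[K] ringClassField K ι 1 ↦ σ rq = rq) (fun σ ↦ σ rp = rp)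
      (fun σ ↦ Affine.Point.map (σ : ringClassField K ι 1 →ₐ[K] ringClassField K ι 1) d.y)
  obtain ⟨n₀, t, hn₀, ht, hZ4⟩ := four_zsmul_quarterPoint hT2 hΨ4 hPe hPq hPp hte' htq' htp'
  obtain ⟨Z, hZ⟩ : ∃ X : (cm7.baseChange (ringClassField K ι 1)).toAffine.Point,
      X = (n₀ * (Me * Mq * Mp)) • Ψ - (n₀ * (Mq * Mp)) • Re - (n₀ * (Me * Mp) * m) • Y - (n₀ * (Me * Mq)) • Rp := ⟨_, rfl⟩
  rw [← hZ] at hZ4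
  ------------------------------------------------------------------ `hKey`: `[η_σ̃]₂ = O` (X1 §5, with X2's key lemma as `hX2`)
  have hPe' := hPe
  have hPp' := hPp
  rw [hdy] at hPe' hPp'
  obtain ⟨kK, hkK, hK0⟩ := exists_odd_zsmul_cosetEta_eq_zero (K := K) hrpK hrp0 hxy hx2 hX2 h4 (hn₀.mul ((hMe.mul hMq).mul hMp))
    (show n₀ * (Me * Mq * Mp) = (n₀ * (Mq * Mp)) * Me by ring) (show n₀ * (Me * Mq * Mp) = (n₀ * (Me * Mq)) * Mp by ring)
    hPe' hPp' hte' htp'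
  rw [← hdy, ← hΨ] at hK0
  -- `σ̃Ψ = Ψ₊₋` (X1 §3)
  have hcos : Affine.Point.map (σt : ringClassField K ι 1 →ₐ[K] ringClassField K ι 1) Ψ =
      ∑ σ : ringClassField K ι 1 ≃ₐ[K] ringClassField K ι 1, (@ite ℤ (σ rq = rq ∧ σ rp = -rp) instDecidableAnd (1 : ℤ) 0) •
        Affine.Point.map (σ : ringClassField K ι 1 →ₐ[K] ringClassField K ι 1) d.y := by
    rw [hΨ]; exact map_quarterSum_eq_cosetSum σt hrK hrpK hrp0 hσq hσp d.y
  ------------------------------------------------------------------ X4's core: `χ_Z(σ̃) = T`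
  have hχ := exists_odd_zsmul_map_sub_eq_twoTorsion
    (Affine.Point.map (σt : ringClassField K ι 1 →ₐ[K] ringClassField K ι 1)) hT2 (hn₀.mul (hMq.mul hMp)) hZ (hYfix σt hσq)
    (hsigP σt hσq hσp) (hsig σt hσq hσp)
    ⟨kK, hkK, by rw [hcos]; exact hK0⟩
  exact ⟨n₀ * (Me * Mq * Mp), Z, t, hn₀.mul ((hMe.mul hMq).mul hMp), ht, hZ4, hχ⟩

/-! ## §2 The conductor-`1` Heegner trace is non-torsion on the type-α cells, GRANTED `h2` (the χ_Z channel; no `(1+c)`-parity) -/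

/-- **Type α, `q ≡ 7 (8)`, `p ≡ 1 (mod 4)` (C4 ∪ C7A), GRANTED `h2`: the conductor-`1` trace `Σ_σ σ y₁ ∈ X₀(49)(K[1])` has INFINITE order** — Z1's
`trace_not_isOfFinAddOrder_of_quarterPoint` on §1's quarter point (`χ_Z(σ̃_p) = T`). On C7A (`p ≡ 1 (8)`) this is the RANK-AXIS core that the `(1+c)`-parity
(†) cannot supply; `h2` is `analyticRank_eq_one_oddTwoPrimesTwist_of_thmA_pOne` (D3). [cite: GrossLMS1991, Prop. 5.3] [cite: Gross1984, §§4–5]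
[cite: CoatesLiTianZhai2015, Thm. 1.3, 1.4, 4.4 and (2.8)] -/
theorem heegnerTrace_not_isOfFinAddOrder_alpha_modFour_of_h2 (hEta₀ : x049_x_sub_two_eq_etaQuotient) (hD : deuring_etaQuotient49_heegner_generates_conjPrime)
    (hEta : x049_heegner_norm_x_sub_two_not_mem) (h14 : thm14_rankOne_twist) (hCST : thm11_ringClassChar)
    (hGZ : ∀ (N : ℕ) [NeZero N] (W : WeierstrassCurve ℚ) (K : Type) [Field K] [NumberField K], gross_zagier N W K)
    (h12 : thm12_fullBSD_twist) (h44 : thm44_ord_two_LAlg)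
    (hS31 : bsdTriple_of_rank_le_one_of_conductor_lt) (hnew : exists_isNewformOf)
    (hBT : burungaleTian_analyticRank_eq_zero_of_selmerCorank_eq_zero_of_hasCM) (hBF : bsdTriple_of_hasCM_of_L_one_ne_zero)
    (hGZK : rank_eq_analyticRank_of_analyticRank_le_one)
    (hK : IsImaginaryQuadratic K) {q p : ℕ} (hq : q.Prime) (hq8 : q % 8 = 7) (hq7 : jacobiSym q 7 = -1)
    [Fact p.Prime] (hp4 : p % 4 = 1) (hp7 : legendreSym p (-7) = 1) (hα : ¬ ∃ x : ZMod p, x ^ 4 = -7)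
    (h4e : ∀ Δ : OrderCl.NegDiscr, Δ.D = -((q : ℤ) * p) → ¬ 4 ∣ Nat.card (ClassGroup (OrderCl.QO Δ)))
    (h2 : (haveI := cm7.isElliptic_quadraticTwist (show (-((q : ℚ) * p)) ≠ 0 from neg_ne_zero.mpr (mul_ne_zero
        (by exact_mod_cast hq.ne_zero) (by exact_mod_cast (Fact.out : p.Prime).ne_zero)));
      (cm7.quadraticTwist (-((q : ℚ) * p))).analyticRank) = 1)
    (hA : ∀ (K₂ : Type) [Field K₂] [NumberField K₂], IsImaginaryQuadratic K₂ → NumberField.discr K₂ = -(8 * (q : ℤ)) →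
      ∀ P : (cm7.baseChange K₂).toAffine.Point, IsHeegnerPoint 49 cm7 K₂ P → ¬ IsOfFinAddOrder P)
    (har : ∀ (W : WeierstrassCurve ℚ) [W.IsElliptic] (C : VariableChange ℚ),
      C • W = cm7.quadraticTwist ((-2 * q : ℤ) : ℚ) → W.analyticRank = 1)
    (hdK : NumberField.discr K = -(8 * (q : ℤ) * p))
    (D₀ : ModularParametrizationData cm7 49) (hc : |D₀.c| = 1) (hw : cm7.rootNumber = 1)
    (h0 : ∃ h, D₀.cuspZeroPoint = Affine.Point.some 2 (-1) h)
    {β : ℤ} (d : KolyvaginHeegnerData D₀ β ι 1) {rq rp : ringClassField K ι 1}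
    (hrq : (rq : ℂ) ^ 2 = -(q : ℂ)) (hrp : (rp : ℂ) ^ 2 = (p : ℂ))
    (B : AddSubgroup (cm7.baseChange ℂ).toAffine.Point) (S : Subfield ℂ)
    (hBfix : ∀ P : (cm7.baseChange (ringClassField K ι 1)).toAffine.Point,
      (∀ σ : ringClassField K ι 1 ≃ₐ[K] ringClassField K ι 1, σ rq = rq → σ rp = rp →
        Affine.Point.map (σ : ringClassField K ι 1 →ₐ[K] ringClassField K ι 1) P = P) →
      Affine.Point.map (W' := cm7) (ringClassField K ι 1).subtype.toRatAlgHom P ∈ B)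
    (hBodd : ∀ u ∈ B, IsOfFinAddOrder u → ∃ n : ℤ, Odd n ∧
      (n • u = 0 ∨ n • u = Affine.Point.some 2 (-1) (nonsingular_cm7_baseChange_two_neg_one ℂ)))
    (hBS : ∀ (E : Type) [Field E] [CharZero E] (e : E →+* ℂ), e.fieldRange ≤ S →
      ∀ z : (cm7.baseChange E).toAffine.Point, Affine.Point.map (W' := cm7) e.toRatAlgHom z ∈ B)
    (hSK : ∀ k : K, ι k ∈ S) (hSq : (rq : ℂ) ∈ S) (hSp : (rp : ℂ) ∈ S)
    (hBL : ∀ z ∈ B, ∃ P : (cm7.baseChange (ringClassField K ι 1)).toAffine.Point,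
      Affine.Point.map (W' := cm7) (ringClassField K ι 1).subtype.toRatAlgHom P = z)
    (h7 : ¬ IsSquare (-7 : ringClassField K ι 1)) (h7' : ¬ IsSquare (7 : ringClassField K ι 1))
    (σt : ringClassField K ι 1 ≃ₐ[K] ringClassField K ι 1) (hσq : σt rq = rq) (hσp : σt rp = -rp) :
    ¬ IsOfFinAddOrder (∑ σ : ringClassField K ι 1 ≃ₐ[K] ringClassField K ι 1,
        Affine.Point.map (σ : ringClassField K ι 1 →ₐ[K] ringClassField K ι 1) d.y) := by
  obtain ⟨N, Z, t, -, ht, hZ4, hχ⟩ := exists_quarterPoint_chiZ_alpha_modFourAlpha ι hEta₀ hD hEta h14 hCST hGZ h12 h44 hS31 hnew hBT hBF hGZK hK hq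
    hq8 hq7 hp4 hp7 hα h4e h2 hA har hdK D₀ hc hw h0 d hrq hrp B S hBfix hBodd hBS hSK hSq hSp hBL h7 h7' σt hσq hσp
  exact trace_not_isOfFinAddOrder_of_quarterPoint hEta hK ι D₀ hc d σt ht hZ4 hχ

end QuarterPoint

end Summit.BirchSwinnertonDyer.BirchSwinnertonDyer.Theorems.GoldfeldGoodTwists

end
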